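import Mathlib
import Literature.AlgebraicGeometry.Resolution.LocalBlowup
import Literature.AlgebraicGeometry.Resolution.LocalUniformization
import Literature.AlgebraicGeometry.Resolution.CentreLocalRingLemmas
import Literature.AlgebraicGeometry.Resolution.RankOneReductionProofs
import Literature.RingTheory.KrullDimension.AffineCatenary
import Summits.ResolutionOfSingularities.ResolutionOfSingularities.Theses.HomologicalConductor
import Summits.ResolutionOfSingularities.ResolutionOfSingularities.Theorems.HomologicalConductorGlobalisationLocEq
import Summits.ResolutionOfSingularities.ResolutionOfSingularities.Theorems.HomologicalConductorStrictDropTowerDimAntitone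
import Summits.ResolutionOfSingularities.ResolutionOfSingularities.Theorems.HomologicalConductorNoZenoTowerGroundChange
import Summits.ResolutionOfSingularities.ResolutionOfSingularities.Theorems.HomologicalConductorNoZenoRebase
import Summits.ResolutionOfSingularities.ResolutionOfSingularities.Theorems.HomologicalConductorNoZenoIffKernel
import Summits.ResolutionOfSingularities.ResolutionOfSingularities.Theorems.HomologicalConductorStrictDropKernelTerminalDim
import Summits.ResolutionOfSingularities.ResolutionOfSingularities.Theorems.HomologicalConductorStrictDropKernelIff
import HarnessLib

/-!
# Crux `StrictDrop` (stmt-ResolutionOfSingularities-16485): RE-GROUNDING — the kill test `SurfaceTermination`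
# (stmt-16488) reaches EVERY datum whose canonical tower hits Krull dimension two, and the crux is reduced to
# towers of terminal dimension `≥ 3`

Route `ResolutionOfSingularities/HomologicalConductor`; Birth vocabulary `NoZeno.Birth.tower` (definitionally the
route's `let`-telescope).  OURS (cell decomp-res, hand leafhand-res-homologicalconduct-3); AI-written support lemmas,
weaker than expert review; nothing here is a statement of any manuscript under review.  SUPPORT-level: doors between
two OPEN leaves of one route (the last theorem concludes the crux `StrictDrop` BY NAME under hypotheses — a
conditional result, not a closure); resolution of singularities in positive characteristic is NOT proved here.

The kill test `SurfaceTermination` is stated for data with `ringKrullDim A = 2`, i.e. `tr.deg_k K = 2`.  Along a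
valuation whose centres have residue fields of positive transcendence degree over `k`, the stages of the canonical
tower of a datum with `tr.deg_k K ≥ 3` can nevertheless have Krull dimension `2`; this file shows that the kill
test covers those too, because every item of the route quantifies over ALL ground fields:

* `exists_intermediateField_le_locAtCentre` — for a finitely generated `Am ⊆ O` with centre `𝔮` (`ht 𝔮 = h`,
  `dim Am = N`): lifting a transcendence basis of `Am/𝔮` over `k` to `Am` gives a purely transcendental
  intermediate field `k ⊆ F ⊆ K` with `F ⊆ (Am)_𝔮` (denominators are polynomials in the lifts, non-zero modulo
  `𝔮` by algebraic independence, hence `O`-units) and `tr.deg_k F ≥ r`, `r + h = N` (affine dimension formula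
  `dim Am/𝔮 + ht 𝔮 = dim Am`, tree `Literature.RingTheory.KrullDimension.ringKrullDim_quotient_add_height`).
* **`exists_isRegularLocalRing_tower_of_ringKrullDim_eq_two`** — `SurfaceTermination` ⇒ for every datum
  `(p, k, K, O, A)` and every `m₀` with `ringKrullDim T_(m₀) = 2`, some stage of the tower is a regular local ring.
  Proof: with `F` as above (`h = 2`), `A' := F[Am]` is a finitely generated `F`-subalgebra of `T_(m₀)` with
  `(A')_{𝔪_O ∩ A'} = T_(m₀)`, `Frac A' = K`, and `dim A' = tr.deg_F K = tr.deg_k K − tr.deg_k F ≤ N − r = 2`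
  (Mathlib `trdeg_add_eq`), `≥ ht = 2`; the kill test over `F` (`CharP F p`, `F ⊆ T_(m₀) ⊆ O`) yields a regular
  stage of the `F`-tower of `A'`, i.e. of the `F`-tower of `loc A' = T_(m₀)` (`NoZeno.Birth.tower_tower`), whose
  stages have the same underlying rings as the `k`-tower of `T_(m₀)` (`GroundChange.isRegularLocalRing_tower_iff`,
  p799881: the tower does not see the ground field), which is the `k`-tower of `A` from `m₀` on.
* `kernel_terminalDimTwo_of_surfaceTermination` — hence the terminal-dimension-`2` slice of the registered kernel
  `stub_dichotomy_dimGETwo` holds given the kill test (vacuously: such runs of singular stages do not exist).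
* `dichotomy_dimGETwo_of_surfaceTermination_of_slices_ge_three` — with the landed split
  `TerminalDim.dichotomy_dimGETwo_iff_forall_terminalDim` (p799256): **kernel ⟸ kill test + slices `e ≥ 3`**.
* `strictDrop_of_surfaceTermination_of_slices_ge_three` — composed with hand-1's
  `KernelIff.strictDrop_of_dichotomy_dimGETwo`: **`StrictDrop` ⟸ `SurfaceTermination` + the terminal-dimension-`≥ 3`
  slices of its kernel.**  What is crux-sized in `StrictDrop` beyond the kill test is exactly: infinite runs of
  singular stages whose Krull dimension stays `≥ 3` (in `tr.deg_k K ≥ 3`).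

References (mechanism only): H. Matsumura, *Commutative Ring Theory*, Thm. 5.6 and §14 (dimension formula for
affine domains) [`Matsumura1987`].
-/

noncomputable section

-- single-problem summit: the doubled namespace component `ResolutionOfSingularities` is forced
set_option linter.dupNamespace false

open IsLocalRing
open Literature.AlgebraicGeometry.Resolution
open Summit.ResolutionOfSingularities.ResolutionOfSingularities.Theses.HomologicalConductor (SurfaceTermination StrictDrop)
open Summit.ResolutionOfSingularities.ResolutionOfSingularities.Theorems.HomologicalConductorGlobalisation (stub_locEq)

namespace Summit.ResolutionOfSingularities.ResolutionOfSingularities.Theorems.NoZeno.Birth.Reground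

variable {k K : Type} [Field k] [Field K] [Algebra k K]

/-- **Lifting a transcendence basis of the residue ring of the centre.**  For a finitely generated `Am ⊆ O` with
centre `𝔮 = 𝔪_O ∩ Am`, there is an intermediate field `k ⊆ F ⊆ K`, purely transcendental over `k` on lifts of a
transcendence basis of `Am/𝔮`, with: `F ⊆ (Am)_𝔮` (inside `K`), and `tr.deg_k F + 2 ≥ dim Am` whenever
`ht 𝔮 = 2` — recorded in the form used below: `F ⊆ locAtCentre Am O` and
`dim Am ≤ tr.deg_k F + ht 𝔮` as natural numbers. [cite: Matsumura1987, Thm. 5.6] [folklore] -/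
theorem exists_intermediateField_le_locAtCentre (O : ValuationSubring K) (Am : Subalgebra k K)
    (hAmfg : Am.FG) (hAmO : Am.toSubring ≤ O.toSubring) {N h : ℕ} (hN : ringKrullDim ↥Am = N)
    (hh : (centreIdeal Am O hAmO).height = h) :
    ∃ F : IntermediateField k K, (F : Set K) ⊆ locAtCentre Am.toSubring O ∧
      ∃ r : ℕ, r + h = N ∧ (r : Cardinal) ≤ Algebra.trdeg k ↥F := by
  classical
  haveI : Algebra.FiniteType k ↥Am := Am.fg_iff_finiteType.mp hAmfg
  set 𝔮 : Ideal ↥Am := centreIdeal Am O hAmO with h𝔮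
  haveI : IsDomain (↥Am ⧸ 𝔮) := Ideal.Quotient.isDomain 𝔮
  haveI : Algebra.FiniteType k (↥Am ⧸ 𝔮) := inferInstance
  -- `dim Am/𝔮 + ht 𝔮 = dim Am`
  obtain ⟨r, hr, hrtr⟩ := exists_ringKrullDim_eq_and_trdeg_eq k (↥Am ⧸ 𝔮)
  have hsum := Literature.RingTheory.KrullDimension.ringKrullDim_quotient_add_height k 𝔮
  rw [hr, hh, hN] at hsum
  have hrN : r + h = N := by exact_mod_cast hsum
  -- a transcendence basis of `Am/𝔮` over `k`, lifted to `Am`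
  haveI : FaithfulSMul k (↥Am ⧸ 𝔮) :=
    (faithfulSMul_iff_algebraMap_injective _ _).mpr (algebraMap k (↥Am ⧸ 𝔮)).injective
  obtain ⟨s, hs⟩ := exists_isTranscendenceBasis k (↥Am ⧸ 𝔮)
  have hscard : Cardinal.mk s = r := by rw [hs.cardinalMk_eq_trdeg, hrtr]
  choose t ht using fun i : s => Ideal.Quotient.mk_surjective (I := 𝔮) (i : ↥Am ⧸ 𝔮)
  have hcomp : (Ideal.Quotient.mkₐ k 𝔮) ∘ t = ((↑) : s → ↥Am ⧸ 𝔮) := funext fun i => ht i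
  have htind : AlgebraicIndependent k t := by
    refine AlgebraicIndependent.of_comp (Ideal.Quotient.mkₐ k 𝔮) ?_
    rw [hcomp]
    exact hs.1
  -- the lifts, read in `K`
  set τ : s → K := fun i => ((t i : ↥Am) : K) with hτ
  have hτind : AlgebraicIndependent k τ := htind.map' (f := Am.val) Subtype.val_injective
  set F : IntermediateField k K := IntermediateField.adjoin k (Set.range τ) with hF
  refine ⟨F, ?_, ?_⟩
  · -- `F ⊆ (Am)_𝔮`: a fraction `a / b` of polynomials in the lifts with `b ≠ 0` has `b ∉ 𝔮`
    intro x hx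
    rw [SetLike.mem_coe, hF, IntermediateField.mem_adjoin_iff_div] at hx
    obtain ⟨a, ha, b, hb, rfl⟩ := hx
    have hkt : Algebra.adjoin k (Set.range τ) ≤ Am := Algebra.adjoin_le (by
      rintro _ ⟨i, rfl⟩
      exact (t i).2)
    by_cases hb0 : b = 0
    · rw [hb0, div_zero]
      exact Subring.zero_mem _
    -- `b ∉ 𝔮`: write `b = aeval τ G`; if `b ∈ 𝔮` then `aeval (mk ∘ t) G = 0`, so `G = 0`
    have hbq : (⟨b, hkt hb⟩ : ↥Am) ∉ 𝔮 := by
      intro hbmem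
      have hb' := hb
      rw [Algebra.adjoin_range_eq_range_aeval] at hb'
      obtain ⟨G, hG⟩ := hb'
      have hG' : ((MvPolynomial.aeval t G : ↥Am) : K) = b := by
        change Am.val (MvPolynomial.aeval t G) = b
        rw [← AlgHom.comp_apply, MvPolynomial.comp_aeval]
        exact hG
      have hGmem : MvPolynomial.aeval t G ∈ 𝔮 := by
        have heq : MvPolynomial.aeval t G = ⟨b, hkt hb⟩ := Subtype.ext hG'
        rw [heq]
        exact hbmem
      have hfun : (fun i : s => Ideal.Quotient.mkₐ k 𝔮 (t i)) = ((↑) : s → ↥Am ⧸ 𝔮) :=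
        funext fun i => ht i
      have h0 : MvPolynomial.aeval ((↑) : s → ↥Am ⧸ 𝔮) G = 0 := by
        rw [← hfun, ← MvPolynomial.comp_aeval, AlgHom.comp_apply, Ideal.Quotient.mkₐ_eq_mk,
          Ideal.Quotient.eq_zero_iff_mem]
        exact hGmem
      have hG0 : G = 0 := hs.1 (by rw [h0, map_zero])
      apply hb0
      rw [← hG, hG0, map_zero]
    have hv1 : O.valuation b = 1 := (not_mem_centreIdeal_iff Am hAmO _).mp hbq
    rw [div_eq_mul_inv]
    exact Subring.mul_mem _ (le_locAtCentre _ O (hkt ha))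
      (inv_mem_locAtCentre (le_locAtCentre _ O (hkt hb)) hv1)
  · -- `tr.deg_k F ≥ #s = r`, and `r + h = N`
    have hτF : ∀ i : s, τ i ∈ F := fun i => IntermediateField.subset_adjoin k _ ⟨i, rfl⟩
    set τ' : s → ↥F := fun i => ⟨τ i, hτF i⟩ with hτ'
    have hτ'ind : AlgebraicIndependent k τ' := by
      refine AlgebraicIndependent.of_comp F.val ?_
      exact hτind
    have hle : Cardinal.mk s ≤ Algebra.trdeg k ↥F := hτ'ind.cardinalMk_le_trdeg
    refine ⟨r, hrN, ?_⟩
    rw [← hscard]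
    exact hle

/-- **THE KILL TEST REACHES EVERY DATUM WHOSE TOWER HITS DIMENSION TWO.**  Assume `SurfaceTermination`
(stmt-16488: for data with `dim A = 2` over any field of characteristic `p`, the canonical tower reaches a regular
stage).  Then for EVERY datum `(k, K, O, A)` of characteristic `p` — any `tr.deg_k K`, any valuation ring `O ∋ k`
— if some stage `T_(m₀)` of the canonical normalised `ca`-tower has Krull dimension `2`, the tower reaches a regular
stage.  Proof (re-grounding): take a finitely generated model `A_(m₀)` of `T_(m₀)` with centre `𝔮` (`ht 𝔮 = 2`,
`dim A_(m₀)/𝔮 = tr.deg_k K − 2`); lift a transcendence basis of `A_(m₀)/𝔮` to `A_(m₀)`: the purely transcendental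
`F = k(t)` lies INSIDE `T_(m₀)` (denominators are off the centre, `exists_intermediateField_le_locAtCentre`), the
finitely generated `F`-algebra `A' = F[A_(m₀)] ⊆ T_(m₀)` has `(A')_{𝔪_O ∩ A'} = T_(m₀)` and Krull dimension
`tr.deg_F K = tr.deg_k K − tr.deg_k F ≤ 2`, `≥ ht = 2`; the kill test over `F` gives a regular stage of the
`F`-tower of `A'`, which is the `k`-tower of `A` from `m₀` on (`GroundChange.tower_toSubring_eq`, the tower does
not see the ground field; `NoZeno.Birth.tower_tower`, restart).  Consequently the terminal-dimension-`2` slice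
of the kernel of crux `StrictDrop` (`HomologicalConductorStrictDropKernelTerminalDim`) is settled by the kill
test, with NO restriction on the residue field of `O`. [cite: Matsumura1987, Thm. 5.6] [folklore] -/
theorem exists_isRegularLocalRing_tower_of_ringKrullDim_eq_two (hS : SurfaceTermination)
    (p : ℕ) (hp : p.Prime) (k K : Type) [Field k] [CharP k p] [Field K] [Algebra k K]
    (O : ValuationSubring K) (A : Subalgebra k K) (hk : ∀ c : k, algebraMap k K c ∈ O) (hA : A.FG)
    (hfr : IsFractionRing ↥A K) (hAO : A.toSubring ≤ O.toSubring) (m₀ : ℕ)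
    (hdim : ringKrullDim ↥(tower O A m₀) = 2) : ∃ n : ℕ, IsRegularLocalRing ↥(tower O A n) := by
  classical
  haveI := hfr
  -- (1) a finitely generated model `Am` of the stage `T := T_(m₀)`
  obtain ⟨Am, hAmfg, hAAm, hAmO, hT⟩ := exists_fg_model_tower O A hA hfr hAO m₀
  haveI : Algebra.FiniteType k ↥Am := Am.fg_iff_finiteType.mp hAmfg
  haveI : IsFractionRing ↥Am K := isFractionRing_subalgebra_of_le A Am hAAm
  have hAmT : Am ≤ tower O A m₀ := fun x hx => by
    have h : x ∈ locAtCentre Am.toSubring O := le_locAtCentre Am.toSubring O hx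
    rw [← hT] at h
    exact h
  have hTO : (tower O A m₀).toSubring ≤ O.toSubring := by
    rw [hT]
    exact locAtCentre_le hAmO
  -- (2) the centre has height `2`; `dim Am = N = tr.deg_k K`
  obtain ⟨N, hN, hNtr⟩ := exists_ringKrullDim_eq_and_trdeg_eq k ↥Am
  have hht : (centreIdeal Am O hAmO).height = ((2 : ℕ) : ℕ∞) := by
    have h1 := ringKrullDim_tower_eq_height_centre O A m₀ hAmO hT
    rw [hdim] at h1
    have h2 : (((centreIdeal Am O hAmO).height : ℕ∞) : WithBot ℕ∞) = ((2 : ℕ∞) : WithBot ℕ∞) := h1.symm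
    exact_mod_cast h2
  -- (3) the intermediate field `F ⊆ T`, `tr.deg_k F ≥ r`, `r + 2 = N`
  obtain ⟨F, hFT', r, hrN, hrle⟩ :=
    exists_intermediateField_le_locAtCentre O Am hAmfg hAmO (h := 2) hN hht
  have hFT : (F : Set K) ⊆ tower O A m₀ := fun x hx => by
    have h : x ∈ locAtCentre Am.toSubring O := hFT' hx
    rw [← hT] at h
    exact h
  have hkF : ∀ c : ↥F, algebraMap (↥F) K c ∈ O := fun c => hTO (hFT c.2)
  haveI : CharP ↥F p := (Algebra.charP_iff k ↥F p).mp inferInstance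
  -- (4) the finitely generated `F`-model `A' = F[Am] ⊆ T`
  obtain ⟨u, hu⟩ := hAmfg
  set A' : Subalgebra ↥F K := Algebra.adjoin ↥F (u : Set K) with hA'
  have hA'fg : A'.FG := ⟨u, rfl⟩
  have hAmA' : (Am : Set K) ⊆ A' := by
    rw [← hu]
    have hle : Algebra.adjoin k (u : Set K) ≤ A'.restrictScalars k :=
      Algebra.adjoin_le (Algebra.subset_adjoin (R := ↥F) (s := (u : Set K)))
    exact fun x hx => hle hx
  -- `T` as an `F`-subalgebra
  let TF : Subalgebra ↥F K :=
    { carrier := (tower O A m₀ : Set K)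
      mul_mem' := fun ha hb => (tower O A m₀).mul_mem ha hb
      one_mem' := (tower O A m₀).one_mem
      add_mem' := fun ha hb => (tower O A m₀).add_mem ha hb
      zero_mem' := (tower O A m₀).zero_mem
      algebraMap_mem' := fun c => hFT c.2 }
  have hA'T : A' ≤ TF := by
    refine Algebra.adjoin_le fun x hx => ?_
    have hxAm : x ∈ Am := by rw [← hu]; exact Algebra.subset_adjoin hx
    exact hAmT hxAm
  have hA'O : A'.toSubring ≤ O.toSubring := fun x hx => hTO (hA'T hx)
  have hA'fr : IsFractionRing ↥A' K := by
    haveI : FaithfulSMul ↥A' K := (faithfulSMul_iff_algebraMap_injective _ _).mpr Subtype.val_injective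
    apply IsFractionRing.of_field
    intro z
    obtain ⟨x, y, -, rfl⟩ := IsFractionRing.div_surjective (A := ↥Am) z
    exact ⟨⟨x, hAmA' x.2⟩, ⟨y, hAmA' y.2⟩, rfl⟩
  -- `(A')_{centre} = T`
  have hTA' : (tower O A m₀).toSubring = locAtCentre A'.toSubring O := by
    apply le_antisymm
    · rw [hT]
      exact locAtCentre_mono O (fun x hx => hAmA' hx)
    · calc locAtCentre A'.toSubring O ≤ locAtCentre (tower O A m₀).toSubring O :=
            locAtCentre_mono O (fun x hx => hA'T hx)
        _ = (tower O A m₀).toSubring := by rw [hT, locAtCentre_locAtCentre]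
  -- (5) `dim A' = 2`
  haveI : Algebra.FiniteType (↥F) ↥A' := A'.fg_iff_finiteType.mp hA'fg
  obtain ⟨M, hM, hMtr⟩ := exists_ringKrullDim_eq_and_trdeg_eq (↥F) ↥A'
  have hdimA' : ringKrullDim ↥A' = 2 := by
    -- `2 = ht (centre on A') ≤ dim A'`
    have hge : (2 : WithBot ℕ∞) ≤ ringKrullDim ↥A' := by
      have h1 := ringKrullDim_tower_eq_height_centre O A m₀ (Am := A'.restrictScalars k) hA'O hTA'
      rw [hdim] at h1
      rw [h1]
      exact Ideal.height_le_ringKrullDim_of_isPrime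
    -- `dim A' = tr.deg_F K ≤ N - r = 2` by additivity of transcendence degrees along `k ⊆ F ⊆ K`
    haveI : IsFractionRing ↥A' K := hA'fr
    have htrFK : Algebra.trdeg (↥F) K = M := by rw [trdeg_eq_trdeg_of_isFractionRing A', hMtr]
    have htrkK : Algebra.trdeg k K = N := by rw [trdeg_eq_trdeg_of_isFractionRing Am, hNtr]
    haveI : FaithfulSMul k ↥F := (faithfulSMul_iff_algebraMap_injective _ _).mpr (algebraMap k ↥F).injective
    haveI : FaithfulSMul (↥F) K := (faithfulSMul_iff_algebraMap_injective _ _).mpr (algebraMap (↥F) K).injective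
    have hadd := trdeg_add_eq k (↥F) (A := K)
    rw [htrFK, htrkK] at hadd
    -- `trdeg k F` is then a natural number `c` with `c + M = N` and `r ≤ c`
    have hcle : Algebra.trdeg k ↥F ≤ N := by rw [← hadd]; exact self_le_add_right _ _
    obtain ⟨c, hc⟩ : ∃ c : ℕ, Algebra.trdeg k ↥F = c := by
      have hlt : Algebra.trdeg k ↥F < Cardinal.aleph0 := lt_of_le_of_lt hcle (Cardinal.natCast_lt_aleph0 (n := N))
      exact Cardinal.lt_aleph0.mp hlt
    rw [hc] at hadd hrle
    have hcM : c + M = N := by exact_mod_cast hadd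
    have hrc : r ≤ c := by exact_mod_cast hrle
    have hM2 : M ≤ 2 := by omega
    have hle2 : ringKrullDim ↥A' ≤ 2 := by rw [hM]; exact_mod_cast hM2
    exact le_antisymm hle2 hge
  -- (6) the kill test over `F`
  obtain ⟨n, hregn⟩ : ∃ n : ℕ, IsRegularLocalRing ↥(tower O A' n) :=
    hS p hp (↥F) K O A' hkF hA'fg hA'fr hA'O hdimA'
  -- (7) back to the `k`-tower: `tower_F O A' n = tower_F O (loc O A') n` has the ring of `tower_k O T n = T_(m₀+n)`
  have hloc : (tower O A m₀).toSubring = (tower O A' 0).toSubring := by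
    rw [tower_zero, loc_eq_locAt]
    change (tower O A m₀).toSubring = (loc O A').toSubring
    rw [hTA']
    exact (stub_locEq O A' hA'O).symm
  have hregn' : IsRegularLocalRing ↥(tower O (tower O A' 0) n) := by
    rw [tower_tower O A' hkF hA'O 0 n, Nat.zero_add]
    exact hregn
  have hregk : IsRegularLocalRing ↥(tower O (tower O A m₀) n) :=
    (GroundChange.isRegularLocalRing_tower_iff F O (tower O A m₀) (tower O A' 0) hloc hFT n).mpr hregn'
  refine ⟨m₀ + n, ?_⟩
  rw [← tower_tower O A hk hAO m₀ n]
  exact hregk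

/-- **The terminal-dimension-two slice of the kernel `stub_dichotomy_dimGETwo` of crux `StrictDrop` holds, given
the kill test** — for every valuation ring and every residue transcendence degree: a run of singular stages whose
Krull dimension is eventually `2` is impossible under `SurfaceTermination`
(`exists_isRegularLocalRing_tower_of_ringKrullDim_eq_two` produces a regular stage, and regular stages persist
upwards, `NoZeno.Birth.tower_succ_eq_self_of_isRegularLocalRing`), so the slice holds vacuously.  Text: the
registered kernel verbatim with `∃ m₀ ≥ m, ∀ n ≥ m₀, ringKrullDim T_n = 2` inserted (the `e = 2` instance of
`TerminalDim.dichotomy_dimGETwo_iff_forall_terminalDim`). [folklore] -/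
theorem kernel_terminalDimTwo_of_surfaceTermination (hS : SurfaceTermination) :
    ∀ p : ℕ, p.Prime → ∀ (k K : Type) [Field k] [CharP k p] [Field K] [Algebra k K] (O : ValuationSubring K) (A : Subalgebra k K), (∀ c : k, algebraMap k K c ∈ O) → A.FG → IsFractionRing ↥A K → A.toSubring ≤ O.toSubring → let ca : Subalgebra k K → Set K := fun A => {x : K | ∃ hx : x ∈ A, ∃ n : ℕ, ∀ i : ℕ, n ≤ i → ∀ (M N : ModuleCat.{0} ↥A), Module.Finite ↥A M → Module.Finite ↥A N → ∀ e : CategoryTheory.Abelian.Ext.{0} M N i, (⟨x, hx⟩ : ↥A) • e = 0}; let loc : Subalgebra k K → Subalgebra k K := fun A => Algebra.adjoin k {y : K | ∃ a ∈ A, ∃ s ∈ A, s⁻¹ ∈ O ∧ y = a * s⁻¹}; let chart : Subalgebra k K → Subalgebra k K := fun A => Algebra.adjoin k ((A : Set K) ∪ {y : K | ∃ c ∈ ca A, ∃ x ∈ ca A, x ≠ 0 ∧ (∀ c' ∈ ca A, c' * x⁻¹ ∈ O) ∧ y = c * x⁻¹}); let nrm : Subalgebra k K → Subalgebra k K :=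 fun B => Algebra.adjoin k {y : K | IsIntegral ↥B y}; let tower : Subalgebra k K → ℕ → Subalgebra k K := fun A m => @Nat.rec (fun _ => Subalgebra k K) (loc A) (fun _ B => loc (nrm (chart B))) m; let Shape : Subalgebra k K → Prop := fun T => (∃ B : Subalgebra k K, B.FG ∧ B ≤ T ∧ loc B = T ∧ ∀ t ∈ T, ∃ b ∈ B, ∃ s ∈ B, s⁻¹ ∈ O ∧ t = b * s⁻¹) ∧ IsNoetherianRing ↥T ∧ T.toSubring ≤ O.toSubring ∧ ∀ s ∈ T, s⁻¹ ∈ O → s⁻¹ ∈ T; (∀ m : ℕ, Shape (tower A m)) → ∀ m : ℕ, (∀ n : ℕ, m ≤ n → ¬ IsRegularLocalRing ↥(tower A n)) → (∀ n : ℕ, m ≤ n → ¬ ringKrullDim ↥(tower A n) ≤ 1) → (∃ m₀ : ℕ, m ≤ m₀ ∧ ∀ n : ℕ, m₀ ≤ n → ringKrullDim ↥(tower A n) = ((2 : ℕ) : WithBot ℕ∞)) → (∃ m' : ℕ, m < m' ∧ ∃ y ∈ ca (tower A m'), y ≠ 0 ∧ ∀ x ∈ ca (tower A m), x ≠ 0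 → y * x⁻¹ ∉ O) ∨ ∃ n : ℕ, m ≤ n ∧ tower A (n + 1) = tower A n := by
  intro p hp k K _ _ _ _ O A hk hA hfr hAO ca loc chart nrm tower Shape _ m hsing _ hrun
  exfalso
  obtain ⟨m₀, hmm₀, hm₀⟩ := hrun
  obtain ⟨n, hregn⟩ : ∃ n : ℕ, IsRegularLocalRing ↥(tower A n) :=
    exists_isRegularLocalRing_tower_of_ringKrullDim_eq_two hS p hp k K O A hk hA hfr hAO m₀ (hm₀ m₀ le_rfl)
  -- regular stages persist: `T_(n+j)` is regular for all `j`
  have hpersist : ∀ j : ℕ, IsRegularLocalRing ↥(tower A (n + j)) := by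
    intro j
    induction j with
    | zero => exact hregn
    | succ j ih =>
      have hstat : tower A (n + j + 1) = tower A (n + j) :=
        NoZeno.Birth.tower_succ_eq_self_of_isRegularLocalRing O A hk hfr hAO (n + j) ih
      rw [← Nat.add_assoc, hstat]
      exact ih
  obtain ⟨j, hj⟩ := Nat.exists_eq_add_of_le (le_max_left n m)
  have hreg : IsRegularLocalRing ↥(tower A (max n m)) := by rw [hj]; exact hpersist j
  exact hsing (max n m) (le_max_right n m) hreg

/-- **Crux `StrictDrop`'s kernel ⟸ the kill test + its terminal-dimension-`≥ 3` slices.**  By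
`TerminalDim.dichotomy_dimGETwo_iff_forall_terminalDim` the registered kernel is the conjunction of its
terminal-dimension-`e` slices (`e ≥ 2`); the slice `e = 2` is `kernel_terminalDimTwo_of_surfaceTermination`.
So, modulo the kill test `SurfaceTermination` (stmt-16488), what is crux-sized in `stub_dichotomy_dimGETwo` is
exactly the family of slices `e ≥ 3` (runs of singular stages of terminal Krull dimension `≥ 3`, in
`tr.deg_k K ≥ 3`). [folklore] -/
theorem dichotomy_dimGETwo_of_surfaceTermination_of_slices_ge_three (hS : SurfaceTermination)
    (h3 : (∀ e : ℕ, 3 ≤ e → ∀ p : ℕ, p.Prime → ∀ (k K : Type) [Field k] [CharP k p] [Field K] [Algebra k K] (O : ValuationSubring K) (A : Subalgebra k K), (∀ c : k, algebraMap k K c ∈ O) → A.FG → IsFractionRing ↥A K → A.toSubring ≤ O.toSubring → let ca : Subalgebra k K → Set K := fun A => {x : K | ∃ hx : x ∈ A, ∃ n : ℕ, ∀ i : ℕ, n ≤ i → ∀ (M N : ModuleCat.{0} ↥A), Module.Finite ↥A M → Module.Finite ↥A N → ∀ e : CategoryTheory.Abelian.Ext.{0} M N i, (⟨x, hx⟩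 : ↥A) • e = 0}; let loc : Subalgebra k K → Subalgebra k K := fun A => Algebra.adjoin k {y : K | ∃ a ∈ A, ∃ s ∈ A, s⁻¹ ∈ O ∧ y = a * s⁻¹}; let chart : Subalgebra k K → Subalgebra k K := fun A => Algebra.adjoin k ((A : Set K) ∪ {y : K | ∃ c ∈ ca A, ∃ x ∈ ca A, x ≠ 0 ∧ (∀ c' ∈ ca A, c' * x⁻¹ ∈ O) ∧ y = c * x⁻¹}); let nrm : Subalgebra k K → Subalgebra k K := fun B => Algebra.adjoin k {y : K | IsIntegral ↥B y}; let tower : Subalgebra k K → ℕ → Subalgebra k K := fun A m => @Nat.rec (fun _ => Subalgebra k K) (loc A) (fun _ B => loc (nrm (chart B))) m; let Shape : Subalgebra k K → Prop := fun T => (∃ B : Subalgebra k K, B.FG ∧ B ≤ T ∧ loc B = T ∧ ∀ t ∈ T, ∃ b ∈ B, ∃ s ∈ B, s⁻¹ ∈ O ∧ t = b * s⁻¹) ∧ IsNoetherianRing ↥T ∧ T.toSubring ≤ O.toSubring ∧ ∀ s ∈ T, s⁻¹ ∈ O → s⁻¹ ∈ T; (∀ m : ℕ, Shape (tower A m)) →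 ∀ m : ℕ, (∀ n : ℕ, m ≤ n → ¬ IsRegularLocalRing ↥(tower A n)) → (∀ n : ℕ, m ≤ n → ¬ ringKrullDim ↥(tower A n) ≤ 1) → (∃ m₀ : ℕ, m ≤ m₀ ∧ ∀ n : ℕ, m₀ ≤ n → ringKrullDim ↥(tower A n) = (e : WithBot ℕ∞)) → (∃ m' : ℕ, m < m' ∧ ∃ y ∈ ca (tower A m'), y ≠ 0 ∧ ∀ x ∈ ca (tower A m), x ≠ 0 → y * x⁻¹ ∉ O) ∨ ∃ n : ℕ, m ≤ n ∧ tower A (n + 1) = tower A n)) :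
    (∀ p : ℕ, p.Prime → ∀ (k K : Type) [Field k] [CharP k p] [Field K] [Algebra k K] (O : ValuationSubring K) (A : Subalgebra k K), (∀ c : k, algebraMap k K c ∈ O) → A.FG → IsFractionRing ↥A K → A.toSubring ≤ O.toSubring → let ca : Subalgebra k K → Set K := fun A => {x : K | ∃ hx : x ∈ A, ∃ n : ℕ, ∀ i : ℕ, n ≤ i → ∀ (M N : ModuleCat.{0} ↥A), Module.Finite ↥A M → Module.Finite ↥A N → ∀ e : CategoryTheory.Abelian.Ext.{0} M N i, (⟨x, hx⟩ : ↥A) • e = 0}; let loc : Subalgebra k K → Subalgebra k K := fun A => Algebra.adjoin k {y : K | ∃ a ∈ A, ∃ s ∈ A, s⁻¹ ∈ O ∧ y = a * s⁻¹}; let chart : Subalgebra k K → Subalgebra k K := fun A => Algebra.adjoin k ((A : Set K) ∪ {y : K | ∃ c ∈ ca A, ∃ x ∈ ca A, x ≠ 0 ∧ (∀ c' ∈ ca A, c' * x⁻¹ ∈ O) ∧ y = c * x⁻¹}); let nrm : Subalgebra k K → Subalgebra k K := fun B => Algebra.adjoin k {y : K | IsIntegral ↥B y}; let tower : Subalgebra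 k K → ℕ → Subalgebra k K := fun A m => @Nat.rec (fun _ => Subalgebra k K) (loc A) (fun _ B => loc (nrm (chart B))) m; let Shape : Subalgebra k K → Prop := fun T => (∃ B : Subalgebra k K, B.FG ∧ B ≤ T ∧ loc B = T ∧ ∀ t ∈ T, ∃ b ∈ B, ∃ s ∈ B, s⁻¹ ∈ O ∧ t = b * s⁻¹) ∧ IsNoetherianRing ↥T ∧ T.toSubring ≤ O.toSubring ∧ ∀ s ∈ T, s⁻¹ ∈ O → s⁻¹ ∈ T; (∀ m : ℕ, Shape (tower A m)) → ∀ m : ℕ, (∀ n : ℕ, m ≤ n → ¬ IsRegularLocalRing ↥(tower A n)) → (∀ n : ℕ, m ≤ n → ¬ ringKrullDim ↥(tower A n) ≤ 1) → (∃ m' : ℕ, m < m' ∧ ∃ y ∈ ca (tower A m'), y ≠ 0 ∧ ∀ x ∈ ca (tower A m), x ≠ 0 → y * x⁻¹ ∉ O) ∨ ∃ n : ℕ, m ≤ n ∧ tower A (n + 1) = tower A n) := by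
  refine StrictDrop.Birth.TerminalDim.dichotomy_dimGETwo_iff_forall_terminalDim.mpr fun e he => ?_
  rcases Nat.lt_or_ge e 3 with hlt | hge
  · obtain rfl : e = 2 := by omega
    exact kernel_terminalDimTwo_of_surfaceTermination hS
  · exact h3 e hge

/-- **Crux `StrictDrop` ⟸ the kill test `SurfaceTermination` + the terminal-dimension-`≥ 3` slices of its
kernel** (the line `birth` composed: `KernelIff.strictDrop_of_dichotomy_dimGETwo`, hand-1, with the kernel
supplied by `dichotomy_dimGETwo_of_surfaceTermination_of_slices_ge_three`).  In particular, in transcendence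
degree `≤ 2` over the ground field nothing beyond the kill test is needed, and in general the crux is reduced
to towers whose stages keep Krull dimension `≥ 3` for ever. [folklore] -/
theorem strictDrop_of_surfaceTermination_of_slices_ge_three (hS : SurfaceTermination)
    (h3 : (∀ e : ℕ, 3 ≤ e → ∀ p : ℕ, p.Prime → ∀ (k K : Type) [Field k] [CharP k p] [Field K] [Algebra k K] (O : ValuationSubring K) (A : Subalgebra k K), (∀ c : k, algebraMap k K c ∈ O) → A.FG → IsFractionRing ↥A K → A.toSubring ≤ O.toSubring → let ca : Subalgebra k K → Set K := fun A => {x : K | ∃ hx : x ∈ A, ∃ n : ℕ, ∀ i : ℕ, n ≤ i → ∀ (M N : ModuleCat.{0} ↥A), Module.Finite ↥A M → Module.Finite ↥A N → ∀ e : CategoryTheory.Abelian.Ext.{0} M N i, (⟨x, hx⟩ : ↥A) • e = 0}; let loc : Subalgebra k K → Subalgebra k K := fun A => Algebra.adjoin k {y : K | ∃ a ∈ A, ∃ s ∈ A, s⁻¹ ∈ O ∧ y = a * s⁻¹}; let chart : Subalgebra k K → Subalgebra k K := fun A => Algebra.adjoin k ((A : Set K) ∪ {y : K | ∃ c ∈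 ca A, ∃ x ∈ ca A, x ≠ 0 ∧ (∀ c' ∈ ca A, c' * x⁻¹ ∈ O) ∧ y = c * x⁻¹}); let nrm : Subalgebra k K → Subalgebra k K := fun B => Algebra.adjoin k {y : K | IsIntegral ↥B y}; let tower : Subalgebra k K → ℕ → Subalgebra k K := fun A m => @Nat.rec (fun _ => Subalgebra k K) (loc A) (fun _ B => loc (nrm (chart B))) m; let Shape : Subalgebra k K → Prop := fun T => (∃ B : Subalgebra k K, B.FG ∧ B ≤ T ∧ loc B = T ∧ ∀ t ∈ T, ∃ b ∈ B, ∃ s ∈ B, s⁻¹ ∈ O ∧ t = b * s⁻¹) ∧ IsNoetherianRing ↥T ∧ T.toSubring ≤ O.toSubring ∧ ∀ s ∈ T, s⁻¹ ∈ O → s⁻¹ ∈ T; (∀ m : ℕ, Shape (tower A m)) → ∀ m : ℕ, (∀ n : ℕ, m ≤ n → ¬ IsRegularLocalRing ↥(tower A n)) → (∀ n : ℕ, m ≤ n → ¬ ringKrullDim ↥(tower A n) ≤ 1) → (∃ m₀ : ℕ, m ≤ m₀ ∧ ∀ n : ℕ, m₀ ≤ n → ringKrullDim ↥(tower A n) =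 (e : WithBot ℕ∞)) → (∃ m' : ℕ, m < m' ∧ ∃ y ∈ ca (tower A m'), y ≠ 0 ∧ ∀ x ∈ ca (tower A m), x ≠ 0 → y * x⁻¹ ∉ O) ∨ ∃ n : ℕ, m ≤ n ∧ tower A (n + 1) = tower A n)) :
    StrictDrop :=
  StrictDrop.Birth.KernelIff.strictDrop_of_dichotomy_dimGETwo
    (dichotomy_dimGETwo_of_surfaceTermination_of_slices_ge_three hS h3)

end Summit.ResolutionOfSingularities.ResolutionOfSingularities.Theorems.NoZeno.Birth.Reground

end
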